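import Summits.CriticalPhenomena.PercolationContinuityZ3.Theorems.PercNearOneGluingNoHeavyLowerTailSahiGridPatternTwoCoord

/-!
# `NoHeavyLowerTail` (crux stmt-CriticalPhenomena-4575), Sahi programme: **SAHI'S `C₃` WITH ONE TWO-COORDINATE SLOT ON EVERY GRID,
# EVERY PRODUCT WEIGHT, EVERY DIMENSION** (localisation of `sStarD_nonneg_of_twoCoord`)

Support file (seat `prim-sahi-p1`, generation 10; `--supports stmt-CriticalPhenomena-4575`).  Pure proofs, no definitions, no `sorry`,
standard axioms.  Vocabulary of `…SahiGridPattern` (`Xd`, `Pd`, `Ssym`, `Tmap`, `pb`, `latticeE3_symm`, `PatternPos`) and `…SahiGridPatternTwoCoord`.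

THE MATHEMATICS.  Let `w = ⊗_a g_a ≥ 0` be a product weight on the grid `[K+1]^d`, `Z` its mass, `m(S) = Σ_{x∈S} w(x)`, and let `A, B, C` be
up-sets (increasing events) of the grid.  Sahi's third-order functional of the indicators in homogeneous form is
`latticeE3 w A B C = 2Z²m(ABC) + m(A)m(B)m(C) − Z[m(A)m(BC) + m(B)m(AC) + m(C)m(AB)] = Z³·E₃(1_A,1_B,1_C)` (Lieb–Sahi 2022 (2.1)).
* `sStarD_nonneg_of_depOn` (pattern level, every `d`): if the up-set `A ⊆ [3]^d` depends only on a set `J` of at most two coordinates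
  (`x|_J = y|_J ⟹ (x ∈ A ↔ y ∈ A)`), then `0 ≤ sStarD A B C` for all up-sets `B, C` (`…TwoCoord` for `|J| = 2`; `|J| ≤ 1` and `d ≤ 1` reduce to it,
  `d ≤ 1` through `PatternPos 2`, which itself is the case `J = {0,1}` — `patternPos_two_of_twoCoord`, a kernel proof of `PatternPos 2` independent of
  the slice certificates of `…SahiGridPatternKernel`).
* `Ssym_nonneg_depOn`: the pull-back of such an `A` along a sorted three-point sample of the grid depends on the same coordinates, so the symmetrised
  pattern value is `≥ 0`.
* **`latticeE3_gridProd_nonneg_depOn`** (every `d`, `K`): for every nonnegative product weight on `[K+1]^d`, every up-set `A` depending on at most two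
  coordinates and ALL up-sets `B, C`: `0 ≤ latticeE3 w A B C`; **`sahiE_three_depOn_nonneg`**: the same for a product PROBABILITY weight in Sahi's
  normalisation, `0 ≤ E₃(1_A,1_B,1_C)` (`sahiE μ 3 ![1_A,1_B,1_C]`).
This is Sahi's conjecture `C₃` (Sahi 2008 Conj. 5 at `n = 3`) / Kahn's Conjecture 5 on grids when ONE of the three increasing events is measurable
with respect to two coordinates (a monotone event of the sub-grid `[K+1]^2`, e.g. `{x_i ≥ s ∨ x_j ≥ t}`, `{x_i + x_j ≥ s}`, any staircase) and the other two
are ARBITRARY increasing events, for every product measure on every finite grid `[K+1]^d`, every `d` — indeed coefficientwise in the chain weights.  Known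
neighbours: all three slots rectangles/orthants (Lieb–Sahi 2022), the whole `2`-dimensional grid (Lieb–Sahi 2022 Thm 2.1: `d = 2`, all slots), one orthant /
co-orthant / nested-canalysing slot (this programme, `…OrthantGrid`, `…CoOrthant`, `…Canalysing`), one principal slot at the measure level (`latticeE3_nonneg_of_principal`,
`sahiE3_cylinder_nonneg`).  HONEST LABEL: slots depending on three or more coordinates are certificate-grade only (`k = 3`) or open; Sahi's `C₃`, Kahn's
conjecture and `PatternPos d` (`d ≥ 4`) remain OPEN; nothing here asserts them. [this work]
-/

namespace Summit.CriticalPhenomena.PercolationContinuityZ3.Theorems.SahiGridPattern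

open Finset Literature.Probability.LatticeModels Literature.Combinatorics.Sahi2008
open SahiGrid3 (ind)
open scoped BigOperators

variable {d K : ℕ}

/-! ### Pattern level: dependence on a set of at most two coordinates -/

/-- **`PatternPos 2` from the two-coordinate theorem** (kernel, no certificates): every up-set of `[3]^2` depends on the two coordinates `0 ≠ 1`.
[this work] -/
theorem patternPos_two_of_twoCoord : PatternPos 2 := fun A B C hA hB hC =>
  sStarD_nonneg_of_twoCoord (0 : Fin 2) 1 Fin.zero_ne_one hA
    (fun x y h0 h1 => by
      have e : x = y := by
        funext a
        match a with
        | ⟨0, _⟩ => exact h0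
        | ⟨1, _⟩ => exact h1
      rw [e])
    B C hB hC

/-- **Every slot depending on at most two coordinates is good, every dimension**: if the up-set `A ⊆ [3]^d` satisfies
`(∀ a ∈ J, x a = y a) → (x ∈ A ↔ y ∈ A)` for a set `J` of at most two coordinates, then `0 ≤ sStarD A B C` for all up-sets `B, C`. [this work] -/
theorem sStarD_nonneg_of_depOn (J : Finset (Fin d)) (hJ : J.card ≤ 2) {A : Finset (Pd d)} (hA : IsUpperSet (A : Set (Pd d)))
    (hdep : ∀ x y : Pd d, (∀ a ∈ J, x a = y a) → (x ∈ A ↔ y ∈ A))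
    (B C : Finset (Pd d)) (hB : IsUpperSet (B : Set (Pd d))) (hC : IsUpperSet (C : Set (Pd d))) :
    0 ≤ sStarD A B C := by
  by_cases hd : d ≤ 2
  · -- small dimensions: `PatternPos d` for `d ≤ 2`
    exact patternPos_of_le hd patternPos_two_of_twoCoord A B C hA hB hC
  · -- `d ≥ 3`: enlarge `J` to exactly two distinct coordinates `i ≠ j`
    have hd3 : 3 ≤ d := by omega
    -- two distinct indices containing `J`
    obtain ⟨i, j, hij, hJsub⟩ : ∃ i j : Fin d, i ≠ j ∧ ∀ a ∈ J, a = i ∨ a = j := by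
      have three : ∀ a : Fin d, ∃ b : Fin d, b ≠ a := fun a => by
        by_cases ha : (a : ℕ) = 0
        · exact ⟨⟨1, by omega⟩, fun h => by have := congrArg Fin.val h; simp [ha] at this⟩
        · exact ⟨⟨0, by omega⟩, fun h => by have := congrArg Fin.val h; simp at this; omega⟩
      rcases Nat.lt_or_ge J.card 1 with h0 | h1
      · -- `J = ∅`
        have hJ0 : J = ∅ := Finset.card_eq_zero.1 (show J.card = 0 by omega)
        refine ⟨⟨0, by omega⟩, ⟨1, by omega⟩, fun h => by have := congrArg Fin.val h; simp at this, ?_⟩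
        intro a ha; rw [hJ0] at ha; simp at ha
      rcases Nat.lt_or_ge J.card 2 with h1' | h2
      · -- `J = {a}`
        obtain ⟨a, hJa⟩ := Finset.card_eq_one.1 (show J.card = 1 by omega)
        obtain ⟨b, hb⟩ := three a
        refine ⟨a, b, hb.symm, fun x hx => ?_⟩
        rw [hJa, Finset.mem_singleton] at hx; exact Or.inl hx
      · -- `J = {a, b}`
        obtain ⟨a, b, hab, hJab⟩ := Finset.card_eq_two.1 (show J.card = 2 by omega)
        refine ⟨a, b, hab, fun x hx => ?_⟩
        rw [hJab, Finset.mem_insert, Finset.mem_singleton] at hx; exact hx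
    refine sStarD_nonneg_of_twoCoord i j hij hA (fun x y hi hj => hdep x y fun a ha => ?_) B C hB hC
    rcases hJsub a ha with rfl | rfl
    · exact hi
    · exact hj

/-- Slot-permuted form: the structured set in the second position. [this work] -/
theorem sStarD_nonneg_of_depOn₂ (J : Finset (Fin d)) (hJ : J.card ≤ 2) {A B C : Finset (Pd d)} (hB : IsUpperSet (B : Set (Pd d)))
    (hdep : ∀ x y : Pd d, (∀ a ∈ J, x a = y a) → (x ∈ B ↔ y ∈ B))
    (hA : IsUpperSet (A : Set (Pd d))) (hC : IsUpperSet (C : Set (Pd d))) : 0 ≤ sStarD A B C := by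
  rw [sStarD_swap12]; exact sStarD_nonneg_of_depOn J hJ hB hdep A C hA hC

/-- Slot-permuted form: the structured set in the third position. [this work] -/
theorem sStarD_nonneg_of_depOn₃ (J : Finset (Fin d)) (hJ : J.card ≤ 2) {A B C : Finset (Pd d)} (hC : IsUpperSet (C : Set (Pd d)))
    (hdep : ∀ x y : Pd d, (∀ a ∈ J, x a = y a) → (x ∈ C ↔ y ∈ C))
    (hA : IsUpperSet (A : Set (Pd d))) (hB : IsUpperSet (B : Set (Pd d))) : 0 ≤ sStarD A B C := by
  rw [sStarD_swap23, sStarD_swap12]; exact sStarD_nonneg_of_depOn J hJ hC hdep A B hA hB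

/-! ### Grid level: the symmetrised pattern value and Sahi's functional -/

/-- **The symmetrised pattern value of (two-coordinate up-set, up-set, up-set) is nonnegative** at every three-point sample `ω` of the grid
`[K+1]^d`: after sorting, the pull-back of `A` is an up-set of `[3]^d` depending on the same coordinates. [this work] -/
theorem Ssym_nonneg_depOn (J : Finset (Fin d)) (hJ : J.card ≤ 2) {A B C : Finset (Xd d K)} (hA : IsUpperSet (A : Set (Xd d K)))
    (hdep : ∀ x y : Xd d K, (∀ a ∈ J, x a = y a) → (x ∈ A ↔ y ∈ A))
    (hB : IsUpperSet (B : Set (Xd d K))) (hC : IsUpperSet (C : Set (Xd d K))) (ω : Fin 3 → Xd d K) :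
    0 ≤ Ssym A B C ω := by
  let σ : Fin d → Equiv.Perm (Fin 3) := fun a => Tuple.sort fun c => ω c a
  have hsort : ∀ a, Monotone fun c => Tmap σ ω c a := fun a => by
    show Monotone ((fun c => ω c a) ∘ σ a)
    exact Tuple.monotone_sort _
  rw [← S_Tmap A B C σ ω, S_eq_sStarD]
  set ω' : Fin 3 → Xd d K := Tmap σ ω with hω'
  have hdep' : ∀ p q : Pd d, (∀ a ∈ J, p a = q a) → (p ∈ pb ω' A ↔ q ∈ pb ω' A) := by
    intro p q hpq
    unfold pb
    rw [Finset.mem_filter, Finset.mem_filter]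
    simp only [Finset.mem_univ, true_and]
    refine hdep _ _ fun a ha => ?_
    show ω' (p a) a = ω' (q a) a
    rw [hpq a ha]
  exact sStarD_nonneg_of_depOn J hJ (isUpperSet_pb hsort hA) hdep' _ _ (isUpperSet_pb hsort hB) (isUpperSet_pb hsort hC)

/-- **SAHI'S `C₃` WITH ONE TWO-COORDINATE SLOT ON EVERY GRID, homogeneous form** (every `d`, `K`): for every nonnegative product weight
`w = ⊗_a g_a` on `[K+1]^d`, every up-set `A` depending on at most two coordinates and all up-sets `B, C`:
`0 ≤ latticeE3 w A B C` (`= Z³·E₃(1_A,1_B,1_C)`). [this work] -/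
theorem latticeE3_gridProd_nonneg_depOn (g : Fin d → Fin (K + 1) → ℝ) (hg : ∀ a u, 0 ≤ g a u)
    (J : Finset (Fin d)) (hJ : J.card ≤ 2) {A B C : Finset (Xd d K)} (hA : IsUpperSet (A : Set (Xd d K)))
    (hdep : ∀ x y : Xd d K, (∀ a ∈ J, x a = y a) → (x ∈ A ↔ y ∈ A))
    (hB : IsUpperSet (B : Set (Xd d K))) (hC : IsUpperSet (C : Set (Xd d K))) :
    0 ≤ latticeE3 (fun ω : Xd d K => ∏ a, g a (ω a)) A B C := by
  have hcard : (0 : ℝ) < Fintype.card (Fin d → Equiv.Perm (Fin 3)) := by exact_mod_cast Fintype.card_pos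
  have h := latticeE3_symm g A B C
  have hsum : 0 ≤ ∑ ω : Fin 3 → Xd d K, (∏ c, ∏ a, g a (ω c a)) * (Ssym A B C ω : ℝ) :=
    Finset.sum_nonneg fun ω _ => mul_nonneg (Finset.prod_nonneg fun c _ => Finset.prod_nonneg fun a _ => hg a _)
      (by exact_mod_cast Ssym_nonneg_depOn J hJ hA hdep hB hC ω)
  rw [← h] at hsum
  exact (mul_nonneg_iff_of_pos_left hcard).1 hsum

/-- **SAHI'S `C₃` WITH ONE TWO-COORDINATE SLOT ON EVERY GRID, probability form** (every `d`, `K`): for every product probability weight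
`w = ⊗ g_i` on `[K+1]^d`, every increasing event `A` depending on at most two coordinates and all increasing events `B, C`, Sahi's third-order
functional of the indicators is nonnegative: `0 ≤ E₃(1_A, 1_B, 1_C)`. [this work] -/
theorem sahiE_three_depOn_nonneg (g : Fin d → Fin (K + 1) → ℝ) (hg0 : ∀ i u, 0 ≤ g i u) (hg1 : ∀ i, ∑ u, g i u = 1)
    (J : Finset (Fin d)) (hJ : J.card ≤ 2) {A B C : Finset (Xd d K)} (hA : IsUpperSet (A : Set (Xd d K)))
    (hdep : ∀ x y : Xd d K, (∀ a ∈ J, x a = y a) → (x ∈ A ↔ y ∈ A))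
    (hB : IsUpperSet (B : Set (Xd d K))) (hC : IsUpperSet (C : Set (Xd d K))) :
    0 ≤ sahiE (fun ω : Xd d K => ∏ i, g i (ω i)) 3 ![setInd A, setInd B, setInd C] := by
  classical
  have hsum : ∑ ω : Fin d → Fin (K + 1), ∏ i, g i (ω i) = 1 := by
    rw [← Fintype.prod_sum]; simp [hg1]
  rw [sahiE_three_indicator_eq_latticeE3 hsum]
  exact latticeE3_gridProd_nonneg_depOn g hg0 J hJ hA hdep hB hC

/-- **Example** (the shape of the hypothesis): the increasing event `{x : s ≤ x i ∨ t ≤ x j}` of the grid depends only on `{i, j}`, so for every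
product probability weight and all increasing `B, C`: `0 ≤ E₃(1_{x_i ≥ s ∨ x_j ≥ t}, 1_B, 1_C)`. [this work] -/
theorem sahiE_three_orPair_nonneg (g : Fin d → Fin (K + 1) → ℝ) (hg0 : ∀ i u, 0 ≤ g i u) (hg1 : ∀ i, ∑ u, g i u = 1)
    (i j : Fin d) (s t : Fin (K + 1)) {B C : Finset (Xd d K)} (hB : IsUpperSet (B : Set (Xd d K))) (hC : IsUpperSet (C : Set (Xd d K))) :
    0 ≤ sahiE (fun ω : Xd d K => ∏ i, g i (ω i)) 3
      ![setInd (univ.filter fun x : Xd d K => s ≤ x i ∨ t ≤ x j), setInd B, setInd C] := by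
  classical
  refine sahiE_three_depOn_nonneg g hg0 hg1 ({i, j} : Finset (Fin d)) Finset.card_le_two ?_ ?_ hB hC
  · intro x y hxy hx
    rw [Finset.mem_coe, Finset.mem_filter] at hx ⊢
    refine ⟨Finset.mem_univ _, ?_⟩
    rcases hx.2 with h | h
    · exact Or.inl (le_trans h (hxy i))
    · exact Or.inr (le_trans h (hxy j))
  · intro x y hxy
    rw [Finset.mem_filter, Finset.mem_filter]
    simp only [Finset.mem_univ, true_and]
    rw [hxy i (by simp), hxy j (by simp)]

end Summit.CriticalPhenomena.PercolationContinuityZ3.Theorems.SahiGridPattern
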